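import Literature.MathematicalPhysics.QuantumFieldTheory.Balaban1983to89.B9Eq3119DeltaPiCarrier

/-!
# `Balaban1983to89.B9Eq3119DeltaPiReality` — T. Bałaban, *Propagators for lattice gauge theories in a background field*, Commun. Math. Phys. **99**
# (1985) 389–434 [Balaban1985BackgroundPropagators] p. 392 «For U with values in the unitary group U(N) it is a hermitian operator» FOR THE
# EXTENDED FORM (3.119) p. 419: **at a unitary background print's `π_U = 1 − D_U G′ R(U) D*_U` is REAL (commutes with the involution `A ↦ A*`),
# hence the bilinear-transpose extension `Δ_π(U) = π_Uᵗ Δ^η(U) π_U` of `B9Eq3119DeltaPiCarrier` IS the Hilbert-adjoint extension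
# `π_U† Δ^η(U) π_U` of `B9Eq3119InvariantExtension`, and `Δ_π(U)` is a SYMMETRIC (Hermitian) operator** — at the pub-balaban NE9 chain's letters

statement-level skeleton of published theorems with citation tags; proofs where landed; nothing here is a claim
about the Yang–Mills mass gap

PDF held: `paper:balaban1985-cmp99-background-propagators` (journal page = PDF page + 388), pp. 390–394, 419 read by this seat (2026-08-22) in
the held text layer (p0002–p0006, p0031).

THE PRINT (verbatim).  p. 390: *«R(U)X = UXU⁻¹»*; p. 391 (3.3): *«(D^η_{U₀}A)(b) = η⁻¹(R(U₀(b))A(b₊) − A(b₋))»*; p. 392: *«For U with values in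
the unitary group U(N) it is a hermitian operator»*, (3.8), (3.11); p. 393 (3.19): *«(Q′(V)λ)(y) = Σ_{x∈B(y)} L^{−d}R(V(Γ_{y,x}))λ(x)»*; p. 394
(3.21): *«R = R(U) is an orthogonal projection … onto the subspace ℛ = Δ^η_U N(Q′)»*, (3.23)–(3.25); p. 419 (3.119): *«⟨A, Δ_πA⟩ = ⟨A − DG′RD*A,
Δ(A − DG′RD*A)⟩»*.

WHY THIS FILE (cell context).  The row holds TWO typings of (3.119): `B9Eq3119InvariantExtension` (p303874: `π† ∘ Δ ∘ π`, Hilbert adjoint) and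
`B9Eq3119DeltaPiCarrier` (p308383: `πᵗ ∘ Δ ∘ π`, BILINEAR transpose `πᵗ = (⋆π⋆)†`, bilinear-symmetric with no reality letter — the form W₇
`B11Eq80Current` consumes).  They agree exactly when `π` is REAL (`⋆π⋆ = π`).  This file PROVES that print's `π_U` IS real at every unitary
background: `D_U` (3.3), `D*_U` (3.8), the projection `R(U)` onto `Δ_U N(Q′(U))` (3.21) (`Q′(U)` (3.19) commutes with `⋆` by induction along
the contours, so `Δ_U N(Q′(U))` is `⋆`-invariant, and the orthogonal projection onto a `⋆`-invariant subspace commutes with the ANTI-UNITARY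
`⋆`) and `G′(U) = (Δ′_a(U))⁻¹` (3.25) all commute with `A ↦ A*`.  Consequences: `π_Uᵗ = π_U†`, `deltaPiOfU = π_U† ∘ Δ^η(U) ∘ π_U`, and `Δ_π(U)`
is `LinearMap.IsSymmetric` (what `B11Eq103H1Complex.laplaceALatticeK_isSymmetric` ∕ `B9Eq3124GaugeModes.h124'_RLatticeK` ask of a slot
`Δ₁ := Δ_π(U)`).

WHAT IS PROVED (sorry-free; theorems only; no definition, no `Prop` placeholder; no inequality of the paper).
* §1 reality calculus on the cell's weighted `L²` spaces `WL2 ℂ w W` for the involution `starW φ` of `B9Eq311TracePairing`: `starW_neg`, `starW_sub`,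
  `starW_real_smul`, `realConj_eq_self_iff`, `real_comp`, `real_id`, `real_add`, `real_sub`, `real_smul_ofReal`, **`inner_starW_starW`**
  (`⟪f⋆, g⋆⟫ = conj ⟪f, g⟫`), **`real_adjoint`**, **`real_greenK`**, **`real_starProjection`**.
* §2 at the chain's letters (`hU` unitary; `hφ`, `hτ₁`, `hτ₂` where the inner product enters): `adTransportW_sW`, `adTransportW_inv_sW`,
  **`covDerivL2K_starW`**, **`covDivL2K_starW`**, **`covLaplaceSiteK_starW`**, `stepTransport_sW`, `pathTr_sW`, **`QprimeW_starW`**,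
  `QprimeW_starW_eq_zero`, **`RofU_starW`**, `QtildeW_starW`, **`laplacePrimeA_starW`**, **`GpOfU_starW`**, **`piOfU_starW`**.
* §3 **`btrans_piOfU_eq_adjoint`** (`π_Uᵗ = π_U†`), **`deltaPiOfU_eq_adjoint_form`**, `deltaPiOfU_GpOfU_eq_adjoint_form`,
  **`deltaPiOfU_isSymmetric`**, `deltaPiOfU_GpOfU_isSymmetric` (the `hpos'` of `GpOfU` stays displayed here; `B9Thm311DeltaPrimeA.laplacePrimeA_pos`
  discharges it at every unitary background — one-line corollaries for consumers).
MODEL / DECLARED READINGS.  (M1) the letters of `B9Eq3119DeltaPiCarrier` §5 exactly; (M2) «real» = commuting with `starW φ`; «unitary» =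
`U(b)* = U(b)⁻¹` in `𝔸`; (M3) NOT here: any estimate; W₇'s other letter `J`; non-unitary (complexified) backgrounds, where `π_U` is NOT real
and the two extensions differ (toy: `T = i·1` has `Tᵗ = T ≠ −T = T†`).
HONEST SCOPE.  [folklore] `*`-algebra ∕ anti-unitary-involution bookkeeping over the tree's constructed (3.3)∕(3.8)∕(3.19)∕(3.21)∕(3.24)∕(3.25);
NOT summit progress (cell pub-balaban: NE9 NOT PRINTED ∕ NOT PROVED; spine PROVED 0∕9).  Filed by the pub-balaban NE9 leaf seat
`b2b-balaban-t4-ne9-formalise-leaf-02` (gen 53; X-read C-ne9leaf02g53-1 INFO-2 → RESULT R-ne9leaf02-g53-2, INTENT I-ne9leaf02-g53-2); NEW file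
importing `B9Eq3119DeltaPiCarrier` only; nothing modified.  Net new unproved facts: 0.
-/

noncomputable section

open scoped InnerProductSpace ComplexConjugate BigOperators

namespace Literature.MathematicalPhysics.QuantumFieldTheory.Balaban1983to89.B9Eq3119DeltaPiReality

open B9Eq311L2Pairing (WL2)
open B9Eq311TracePairing (starW equiv_starW apply_equiv_starW starW_starW starW_add starW_smul starW_zero realConj realConj_apply btrans
  inner_starW_left)

/-! ## §1 Generic: real operators between the cell's weighted `L²` spaces (`T ∘ ⋆ = ⋆ ∘ T`) -/

section Generic

variable {𝔸 : Type*} [Ring 𝔸] [StarRing 𝔸] [Algebra ℂ 𝔸] [StarModule ℂ 𝔸]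
  {W : Type*} [NormedAddCommGroup W] [InnerProductSpace ℂ W] (φ : W ≃ₗ[ℂ] 𝔸)
  {ι ι' ι'' : Type*} {w : ι → ℝ} {w' : ι' → ℝ} {w'' : ι'' → ℝ}

omit [StarModule ℂ 𝔸] in
/-- `(−f)⋆ = −f⋆`. [cite: Balaban1985BackgroundPropagators, (3.11) p.392] -/
theorem starW_neg (f : WL2 ℂ w W) : starW φ (-f) = -starW φ f := by
  have h := starW_add φ f (-f)
  rw [add_neg_cancel, starW_zero] at h
  exact (neg_eq_of_add_eq_zero_right h.symm).symm

omit [StarModule ℂ 𝔸] in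
/-- `(f − g)⋆ = f⋆ − g⋆`. [cite: Balaban1985BackgroundPropagators, (3.11) p.392] -/
theorem starW_sub (f g : WL2 ℂ w W) : starW φ (f - g) = starW φ f - starW φ g := by
  rw [sub_eq_add_neg, starW_add, starW_neg, ← sub_eq_add_neg]

/-- `(r·f)⋆ = r·f⋆` for REAL `r`. [cite: Balaban1985BackgroundPropagators, (3.11) p.392] -/
theorem starW_real_smul (r : ℝ) (f : WL2 ℂ w W) : starW φ ((r : ℂ) • f) = (r : ℂ) • starW φ f := by
  rw [starW_smul, Complex.conj_ofReal]

/-- **Reality criterion**: `⋆T⋆ = T` iff `T` commutes with the involution. [cite: Balaban1985BackgroundPropagators, p.390] -/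
theorem realConj_eq_self_iff (T : WL2 ℂ w W →ₗ[ℂ] WL2 ℂ w' W) :
    realConj φ T = T ↔ ∀ f, T (starW φ f) = starW φ (T f) := by
  constructor
  · intro h f
    have := congrArg (fun S => S (starW φ f)) h
    simp only [realConj_apply, starW_starW] at this
    exact this.symm
  · intro h
    apply LinearMap.ext
    intro f
    rw [realConj_apply, h, starW_starW]

omit [StarModule ℂ 𝔸] in
/-- A composite of real operators is real (step of «π_U is real»). [cite: Balaban1985BackgroundPropagators, p.390, (3.119) p.419] -/
theorem real_comp {T : WL2 ℂ w' W →ₗ[ℂ] WL2 ℂ w'' W} {S : WL2 ℂ w W →ₗ[ℂ] WL2 ℂ w' W}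
    (hT : ∀ f, T (starW φ f) = starW φ (T f)) (hS : ∀ f, S (starW φ f) = starW φ (S f)) :
    ∀ f : WL2 ℂ w W, (T ∘ₗ S) (starW φ f) = starW φ ((T ∘ₗ S) f) := fun f => by
  rw [LinearMap.comp_apply, LinearMap.comp_apply, hS, hT]

omit [StarModule ℂ 𝔸] in
/-- The identity is real. [cite: Balaban1985BackgroundPropagators, p.390, (3.119) p.419] -/
theorem real_id :
    ∀ f : WL2 ℂ w W, (LinearMap.id : WL2 ℂ w W →ₗ[ℂ] WL2 ℂ w W) (starW φ f) = starW φ ((LinearMap.id : WL2 ℂ w W →ₗ[ℂ] WL2 ℂ w W) f) :=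
  fun _ => rfl

omit [StarModule ℂ 𝔸] in
/-- A sum of real operators is real. [cite: Balaban1985BackgroundPropagators, p.390, (3.24) p.394] -/
theorem real_add {T S : WL2 ℂ w W →ₗ[ℂ] WL2 ℂ w' W}
    (hT : ∀ f, T (starW φ f) = starW φ (T f)) (hS : ∀ f, S (starW φ f) = starW φ (S f)) :
    ∀ f : WL2 ℂ w W, (T + S) (starW φ f) = starW φ ((T + S) f) := fun f => by
  rw [LinearMap.add_apply, LinearMap.add_apply, hT, hS, starW_add]

omit [StarModule ℂ 𝔸] in
/-- A difference of real operators is real. [cite: Balaban1985BackgroundPropagators, p.390, (3.119) p.419] -/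
theorem real_sub {T S : WL2 ℂ w W →ₗ[ℂ] WL2 ℂ w' W}
    (hT : ∀ f, T (starW φ f) = starW φ (T f)) (hS : ∀ f, S (starW φ f) = starW φ (S f)) :
    ∀ f : WL2 ℂ w W, (T - S) (starW φ f) = starW φ ((T - S) f) := fun f => by
  rw [LinearMap.sub_apply, LinearMap.sub_apply, hT, hS, starW_sub]

/-- A REAL multiple of a real operator is real. [cite: Balaban1985BackgroundPropagators, p.390, (3.24) p.394] -/
theorem real_smul_ofReal {T : WL2 ℂ w W →ₗ[ℂ] WL2 ℂ w' W} (hT : ∀ f, T (starW φ f) = starW φ (T f)) (r : ℝ) :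
    ∀ f : WL2 ℂ w W, ((r : ℂ) • T) (starW φ f) = starW φ (((r : ℂ) • T) f) := fun f => by
  rw [LinearMap.smul_apply, LinearMap.smul_apply, hT, starW_real_smul]

variable [Fintype ι] [Fintype ι'] [Fact (∀ i, 0 < w i)] [Fact (∀ i, 0 < w' i)] [FiniteDimensional ℂ W] (τ : 𝔸 →ₗ[ℂ] ℂ)

omit [StarModule ℂ 𝔸] [FiniteDimensional ℂ W] in
/-- **The involution is ANTI-UNITARY: `⟪f⋆, g⋆⟫ = conj ⟪f, g⟫`** (`*`-trace, the cell's norming). [cite: Balaban1985BackgroundPropagators, (3.11) p.392] -/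
theorem inner_starW_starW (hφ : ∀ X Y : 𝔸, ⟪φ.symm X, φ.symm Y⟫_ℂ = τ (star X * Y)) (hτ₁ : ∀ X : 𝔸, τ (star X) = conj (τ X))
    (hτ₂ : ∀ X Y : 𝔸, τ (X * Y) = τ (Y * X)) (f g : WL2 ℂ w W) : ⟪starW φ f, starW φ g⟫_ℂ = conj ⟪f, g⟫_ℂ := by
  rw [inner_starW_left φ τ hφ hτ₁ hτ₂, starW_starW]

omit [StarModule ℂ 𝔸] in
/-- **The adjoint of a real operator is real** (anti-unitary involutions on both sides) — for `Q′*` in (3.24) and `D* = D†` (3.8). [cite: Balaban1985BackgroundPropagators, (3.8) p.392, (3.24) p.394] -/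
theorem real_adjoint (hφ : ∀ X Y : 𝔸, ⟪φ.symm X, φ.symm Y⟫_ℂ = τ (star X * Y)) (hτ₁ : ∀ X : 𝔸, τ (star X) = conj (τ X))
    (hτ₂ : ∀ X Y : 𝔸, τ (X * Y) = τ (Y * X)) {A : WL2 ℂ w W →ₗ[ℂ] WL2 ℂ w' W} (hA : ∀ f, A (starW φ f) = starW φ (A f)) :
    ∀ g, LinearMap.adjoint A (starW φ g) = starW φ (LinearMap.adjoint A g) := fun g => by
  apply ext_inner_right ℂ
  intro f
  rw [LinearMap.adjoint_inner_left, inner_starW_left φ τ hφ hτ₁ hτ₂, inner_starW_left φ τ hφ hτ₁ hτ₂, ← hA,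
    LinearMap.adjoint_inner_left]

omit [StarModule ℂ 𝔸] [Fintype ι] [Fact (∀ i, 0 < w i)] in
/-- **The Green operator (inverse) of a real operator is real** — for `G′ = (Δ′_a)⁻¹` (3.25). [cite: Balaban1985BackgroundPropagators, (3.25) p.394] -/
theorem real_greenK {T : WL2 ℂ w' W →ₗ[ℂ] WL2 ℂ w' W} (hpos : ∀ x, x ≠ 0 → 0 < RCLike.re ⟪x, T x⟫_ℂ)
    (hT : ∀ f, T (starW φ f) = starW φ (T f)) :
    ∀ f, B11Eq103H1Complex.greenK T hpos (starW φ f) = starW φ (B11Eq103H1Complex.greenK T hpos f) := fun f => by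
  apply B11Eq103H1Complex.injective_of_rePosDef hpos
  rw [B11Eq103H1Complex.apply_greenK, hT, B11Eq103H1Complex.apply_greenK]

omit [StarModule ℂ 𝔸] in
/-- **The orthogonal projection onto a `⋆`-invariant subspace is real** (anti-unitary `⋆`; uniqueness of the projection) — for `R(U)` (3.21). [cite: Balaban1985BackgroundPropagators, (3.21) p.394] -/
theorem real_starProjection (hφ : ∀ X Y : 𝔸, ⟪φ.symm X, φ.symm Y⟫_ℂ = τ (star X * Y)) (hτ₁ : ∀ X : 𝔸, τ (star X) = conj (τ X))
    (hτ₂ : ∀ X Y : 𝔸, τ (X * Y) = τ (Y * X)) (K : Submodule ℂ (WL2 ℂ w W)) (hK : ∀ f ∈ K, starW φ f ∈ K) :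
    ∀ f, K.starProjection (starW φ f) = starW φ (K.starProjection f) := fun f => by
  haveI : CompleteSpace K := FiniteDimensional.complete ℂ _
  apply Submodule.eq_starProjection_of_mem_of_inner_eq_zero (hK _ (K.starProjection_apply_mem f))
  intro g hg
  rw [← starW_sub, inner_starW_left φ τ hφ hτ₁ hτ₂, Submodule.starProjection_inner_eq_zero f _ (hK g hg), map_zero]

end Generic

/-! ## §2 At the chain's letters: `D_U`, `D*_U`, `Δ_U`, `Q′(U)`, `R(U)`, `Δ′_a(U)`, `G′(U)`, `π_U` are REAL at a unitary background -/

section Lattice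

open B4Sect5Torus (TSite)
open B9SectCLatticeCarrier (Bond shift)
open B9Eq319QprimeTorus (fineP stepTransport)
open B9Eq323Ker (pathTr pathTr_cons_cons)
open B9Eq33CovDerivVector (covDeriv covDeriv_apply covDiv)
open B11Eq103H1Complex (SiteL2K BondL2K covDerivL2K covDivL2K covLaplaceSiteK equiv_covDerivL2K equiv_covDivL2K greenK projR RLatticeK)
open B9Eq310HessianOperator (adTransportW adTransportW_apply hessOp)
open B9Eq310HessianHermitian (star_val_inv_of_unitary adTransportW_adjoint)
open B9Eq326OperatorAssembly (QprimeW RofU)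
open B9Eq3119DeltaPiCarrier (piOfU deltaPiOfU deltaPi laplacePrimeA GpOfU)

variable {d : ℕ} (L : ℕ) [NeZero L] (m : Fin d → ℕ) {𝔸 : Type*} [Ring 𝔸] [StarRing 𝔸] [Algebra ℂ 𝔸] [StarModule ℂ 𝔸]
  {W : Type*} [NormedAddCommGroup W] [InnerProductSpace ℂ W] (φ : W ≃ₗ[ℂ] 𝔸) {c₀ : ℝ} [Fact (0 < c₀)]
  (η : ℝ) {U : Bond d (fineP L m) → 𝔸ˣ} (hU : ∀ b, star (U b : 𝔸) = ((U b)⁻¹ : 𝔸ˣ))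


omit [StarModule ℂ 𝔸] in
/-- additivity of the fibre involution. [cite: Balaban1985BackgroundPropagators, (3.11) p.392] -/
theorem sW_add (a b : W) : φ.symm (star (φ (a + b))) = φ.symm (star (φ a)) + φ.symm (star (φ b)) := by simp [map_add, star_add]

omit [StarModule ℂ 𝔸] in
/-- the fibre involution respects differences. [cite: Balaban1985BackgroundPropagators, (3.11) p.392] -/
theorem sW_sub (a b : W) : φ.symm (star (φ (a - b))) = φ.symm (star (φ a)) - φ.symm (star (φ b)) := by simp [map_sub, star_sub]

omit [StarModule ℂ 𝔸] in
/-- `0⋆ = 0`. [cite: Balaban1985BackgroundPropagators, (3.11) p.392] -/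
theorem sW_zero : φ.symm (star (φ (0 : W))) = 0 := by simp

omit [StarModule ℂ 𝔸] in
/-- the fibre involution respects finite sums. [cite: Balaban1985BackgroundPropagators, (3.11) p.392] -/
theorem sW_sum {α : Type*} (s : Finset α) (g : α → W) : φ.symm (star (φ (∑ a ∈ s, g a))) = ∑ a ∈ s, φ.symm (star (φ (g a))) := by
  simp [map_sum, star_sum]

/-- `(c·v)⋆ = c̄·v⋆`. [cite: Balaban1985BackgroundPropagators, (3.11) p.392] -/
theorem sW_smul (c : ℂ) (a : W) : φ.symm (star (φ (c • a))) = conj c • φ.symm (star (φ a)) := by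
  simp [map_smul, star_smul]

/-- `(r·v)⋆ = r·v⋆` for real `r`. [cite: Balaban1985BackgroundPropagators, (3.11) p.392] -/
theorem sW_real_smul (r : ℝ) (a : W) : φ.symm (star (φ (r • a))) = r • φ.symm (star (φ a)) := by
  rw [← Complex.coe_smul, sW_smul, Complex.conj_ofReal, Complex.coe_smul]

omit [StarModule ℂ 𝔸] [Fact (0 < c₀)] in
/-- `starW` is the fibre involution pointwise. [cite: Balaban1985BackgroundPropagators, (3.11) p.392] -/
theorem equiv_starW' {ι : Type*} {w : ι → ℝ} (f : WL2 ℂ w W) (i : ι) : WL2.equiv ℂ w W (starW φ f) i = φ.symm (star (φ (WL2.equiv ℂ w W f i))) := rfl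

include hU in
omit [NeZero L] [StarModule ℂ 𝔸] [Fact (0 < c₀)] in
/-- **`(U X U⁻¹)* = U X* U⁻¹`: `R(U(b))` commutes with the fibre involution at a unitary background.** [cite: Balaban1985BackgroundPropagators, p.390] -/
theorem adTransportW_sW (b : Bond d (fineP L m)) (v : W) : adTransportW φ U b (φ.symm (star (φ v))) = φ.symm (star (φ (adTransportW φ U b v))) := by
  simp only [adTransportW_apply, LinearEquiv.apply_symm_apply, star_mul, hU, star_val_inv_of_unitary hU, mul_assoc]

include hU in
omit [NeZero L] [StarModule ℂ 𝔸] [Fact (0 < c₀)] in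
/-- … and so does `R(U(b)⁻¹)`. [cite: Balaban1985BackgroundPropagators, p.390] -/
theorem adTransportW_inv_sW (b : Bond d (fineP L m)) (v : W) :
    adTransportW φ (fun b => (U b)⁻¹) b (φ.symm (star (φ v))) = φ.symm (star (φ (adTransportW φ (fun b => (U b)⁻¹) b v))) := by
  simp only [adTransportW_apply, LinearEquiv.apply_symm_apply, star_mul, inv_inv, hU, star_val_inv_of_unitary hU, mul_assoc]

include hU in
omit [NeZero L] in
/-- **`D_U` is real**: `D_U(f⋆) = (D_U f)⋆` (unitary `U`, real scalar `η⁻¹`). [cite: Balaban1985BackgroundPropagators, (3.3) p.391] -/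
theorem covDerivL2K_starW (f : SiteL2K ℂ d (fineP L m) c₀ W) :
    covDerivL2K ℂ c₀ ((η : ℂ))⁻¹ (adTransportW φ U) (starW φ f) = starW φ (covDerivL2K ℂ c₀ ((η : ℂ))⁻¹ (adTransportW φ U) f) := by
  apply (WL2.equiv ℂ (fun _ : Bond d (fineP L m) => c₀) W).injective
  funext b
  rw [equiv_covDerivL2K, equiv_starW', equiv_covDerivL2K, covDeriv_apply, covDeriv_apply, equiv_starW', equiv_starW',
    adTransportW_sW L m φ hU, ← sW_sub, sW_smul, map_inv₀, Complex.conj_ofReal]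

include hU in
omit [NeZero L] in
/-- **`D*_U` is real.** [cite: Balaban1985BackgroundPropagators, (3.8) p.392] -/
theorem covDivL2K_starW (A : BondL2K ℂ d (fineP L m) c₀ W) :
    covDivL2K ℂ c₀ ((η : ℂ))⁻¹ (adTransportW φ fun b => (U b)⁻¹) (starW φ A) =
      starW φ (covDivL2K ℂ c₀ ((η : ℂ))⁻¹ (adTransportW φ fun b => (U b)⁻¹) A) := by
  apply (WL2.equiv ℂ (fun _ : TSite d (fineP L m) => c₀) W).injective
  funext x
  rw [equiv_covDivL2K, equiv_starW', equiv_covDivL2K, B9Eq33CovDerivVector.covDiv_apply, B9Eq33CovDerivVector.covDiv_apply,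
    sW_smul, map_inv₀, Complex.conj_ofReal, sW_sum]
  congr 1
  refine Finset.sum_congr rfl fun μ _ => ?_
  rw [equiv_starW', equiv_starW', adTransportW_inv_sW L m φ hU, sW_sub]

include hU in
omit [NeZero L] in
/-- **`Δ_U = D*_U D_U` is real.** [cite: Balaban1985BackgroundPropagators, (3.23) p.394] -/
theorem covLaplaceSiteK_starW (f : SiteL2K ℂ d (fineP L m) c₀ W) :
    covLaplaceSiteK ((η : ℂ))⁻¹ (adTransportW φ U) (adTransportW φ fun b => (U b)⁻¹) (starW φ f) =
      starW φ (covLaplaceSiteK ((η : ℂ))⁻¹ (adTransportW φ U) (adTransportW φ fun b => (U b)⁻¹) f) := by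
  rw [covLaplaceSiteK, LinearMap.comp_apply, LinearMap.comp_apply, covDerivL2K_starW L m φ η hU, covDivL2K_starW L m φ η hU]

include hU in
omit [StarModule ℂ 𝔸] [Fact (0 < c₀)] [NeZero L] in
/-- The contour-step transports commute with the fibre involution. [cite: Balaban1985BackgroundPropagators, (3.19) p.393] -/
theorem stepTransport_sW (x x' : TSite d (fineP L m)) (v : W) :
    stepTransport L m (fun b => (adTransportW φ U b).restrictScalars ℝ) x x' (φ.symm (star (φ v))) =
      φ.symm (star (φ (stepTransport L m (fun b => (adTransportW φ U b).restrictScalars ℝ) x x' v))) := by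
  unfold stepTransport
  split_ifs with h
  · exact adTransportW_sW L m φ hU _ v
  · rfl

include hU in
omit [StarModule ℂ 𝔸] [Fact (0 < c₀)] [NeZero L] in
/-- … hence so does every contour transport `R(U(Γ))` (induction along the contour). [cite: Balaban1985BackgroundPropagators, (3.19) p.393] -/
theorem pathTr_sW : ∀ (p : List (TSite d (fineP L m))) (v : W),
    pathTr (stepTransport L m (fun b => (adTransportW φ U b).restrictScalars ℝ)) p (φ.symm (star (φ v))) =
      φ.symm (star (φ (pathTr (stepTransport L m (fun b => (adTransportW φ U b).restrictScalars ℝ)) p v)))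
  | [], v => rfl
  | [_], v => rfl
  | x :: x' :: rest, v => by
    rw [pathTr_cons_cons, LinearMap.comp_apply, LinearMap.comp_apply, pathTr_sW (x' :: rest) v, stepTransport_sW L m φ hU]

include hU in
omit [Fact (0 < c₀)] in
/-- **`Q′(U)` is real**: `Q′(U)(f⋆)(y) = ((Q′(U)f)(y))⋆` (unitary background; the block weights `L^{−d}` are real). [cite: Balaban1985BackgroundPropagators, (3.19) p.393] -/
theorem QprimeW_starW (f : SiteL2K ℂ d (fineP L m) c₀ W) (y : TSite d m) :
    QprimeW L m φ U (starW φ f) y = φ.symm (star (φ (QprimeW L m φ U f y))) := by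
  unfold QprimeW
  rw [LinearMap.comp_apply, LinearMap.comp_apply, B9Eq319QprimeTorus.QprimeLin_apply, B9Eq319QprimeTorus.QprimeLin_apply,
    B9Eq319QprimeTorus.Qprime, B9Eq319QprimeTorus.Qprime, B9Eq323Ker.avgQ, B9Eq323Ker.avgQ, sW_sum]
  refine Finset.sum_congr rfl fun x _ => ?_
  rw [sW_real_smul, ← pathTr_sW L m φ hU]
  rfl

include hU in
omit [Fact (0 < c₀)] in
/-- `N(Q′(U))` is `⋆`-invariant. [cite: Balaban1985BackgroundPropagators, (3.21) p.394] -/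
theorem QprimeW_starW_eq_zero {f : SiteL2K ℂ d (fineP L m) c₀ W} (hf : QprimeW L m φ U f = 0) : QprimeW L m φ U (starW φ f) = 0 := by
  funext y
  rw [QprimeW_starW L m φ hU, hf, Pi.zero_apply, sW_zero]

variable [FiniteDimensional ℂ W] (τ : 𝔸 →ₗ[ℂ] ℂ) (hφ : ∀ X Y : 𝔸, ⟪φ.symm X, φ.symm Y⟫_ℂ = τ (star X * Y))
  (hτ₁ : ∀ X : 𝔸, τ (star X) = conj (τ X)) (hτ₂ : ∀ X Y : 𝔸, τ (X * Y) = τ (Y * X))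

include hU hφ hτ₁ hτ₂ in
/-- **`R(U)` is real** — the orthogonal projection (3.21) onto the `⋆`-invariant `Δ_U N(Q′(U))`, the involution being anti-unitary. [cite: Balaban1985BackgroundPropagators, (3.21) p.394] -/
theorem RofU_starW (f : SiteL2K ℂ d (fineP L m) c₀ W) : RofU L m φ η U (starW φ f) = starW φ (RofU L m φ η U f) := by
  unfold RofU RLatticeK projR
  simp only [ContinuousLinearMap.coe_coe]
  refine real_starProjection φ τ hφ hτ₁ hτ₂ _ (fun g hg => ?_) f
  obtain ⟨l, hl, rfl⟩ := Submodule.mem_map.1 hg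
  refine Submodule.mem_map.2 ⟨starW φ l, ?_, covLaplaceSiteK_starW L m φ η hU l⟩
  rw [LinearMap.mem_ker] at hl ⊢
  exact QprimeW_starW_eq_zero L m φ hU hl

variable {c₁ : ℝ} [Fact (0 < c₁)] (a' : ℝ)

include hU in
omit [FiniteDimensional ℂ W] [Fact (0 < c₀)] [Fact (0 < c₁)] in
/-- `Q̃′(U)` (`Q′(U)` read into the `c₁`-weighted `L²` space of the unit lattice, as in `laplacePrimeA`) is real. [cite: Balaban1985BackgroundPropagators, (3.24) p.394] -/
theorem QtildeW_starW (f : SiteL2K ℂ d (fineP L m) c₀ W) :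
    ((WL2.linearEquiv ℂ ℂ (fun _ : TSite d m => c₁)).symm.toLinearMap ∘ₗ QprimeW L m φ U) (starW φ f) =
      starW φ (((WL2.linearEquiv ℂ ℂ (fun _ : TSite d m => c₁)).symm.toLinearMap ∘ₗ QprimeW L m φ U) f) := by
  apply (WL2.equiv ℂ (fun _ : TSite d m => c₁) W).injective
  funext y
  rw [equiv_starW']
  simp only [LinearMap.comp_apply, LinearEquiv.coe_coe, WL2.linearEquiv_symm_apply, Equiv.apply_symm_apply]
  exact QprimeW_starW L m φ hU f y

include hU hφ hτ₁ hτ₂ in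
/-- **`Δ′_a(U) = Δ_U + Q′(U)†a′Q′(U)` is real** (`a′` real; the adjoint of the real `Q̃′(U)` is real). [cite: Balaban1985BackgroundPropagators, (3.24) p.394] -/
theorem laplacePrimeA_starW (f : SiteL2K ℂ d (fineP L m) c₀ W) :
    laplacePrimeA L m φ η U a' (c₁ := c₁) (starW φ f) = starW φ (laplacePrimeA L m φ η U a' (c₁ := c₁) f) := by
  rw [laplacePrimeA]
  refine real_add φ (covLaplaceSiteK_starW L m φ η hU) (real_smul_ofReal φ (real_comp φ ?_ (QtildeW_starW L m φ hU)) a') f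
  exact real_adjoint φ τ hφ hτ₁ hτ₂ (QtildeW_starW L m φ hU)

include hU hφ hτ₁ hτ₂ in
/-- **`G′(U) = (Δ′_a(U))⁻¹` is real.** [cite: Balaban1985BackgroundPropagators, (3.25) p.394] -/
theorem GpOfU_starW (hpos' : ∀ x : SiteL2K ℂ d (fineP L m) c₀ W, x ≠ 0 → 0 < RCLike.re ⟪x, laplacePrimeA L m φ η U a' (c₁ := c₁) x⟫_ℂ)
    (f : SiteL2K ℂ d (fineP L m) c₀ W) : GpOfU L m φ η U a' hpos' (starW φ f) = starW φ (GpOfU L m φ η U a' hpos' f) :=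
  real_greenK φ hpos' (laplacePrimeA_starW L m φ η hU τ hφ hτ₁ hτ₂ a') f

include hU hφ hτ₁ hτ₂ in
/-- **Print's `π_U = 1 − D_U G′ R(U) D*_U` IS REAL** at a unitary background, for any REAL Green's-function letter `G′`. [cite: Balaban1985BackgroundPropagators, (3.119) p.419] -/
theorem piOfU_starW {Gp : SiteL2K ℂ d (fineP L m) c₀ W →ₗ[ℂ] SiteL2K ℂ d (fineP L m) c₀ W} (hGp : ∀ f, Gp (starW φ f) = starW φ (Gp f))
    (A : BondL2K ℂ d (fineP L m) c₀ W) : piOfU L m φ η U Gp (starW φ A) = starW φ (piOfU L m φ η U Gp A) := by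
  rw [piOfU]
  exact real_sub φ (real_id φ) (real_comp φ (covDerivL2K_starW L m φ η hU)
    (real_comp φ hGp (real_comp φ (RofU_starW L m φ η hU τ hφ hτ₁ hτ₂) (covDivL2K_starW L m φ η hU)))) A

/-! ## §3 Conclusion: at a unitary background `π_Uᵗ = π_U†`, so (II)'s `Δ_π(U)` IS p303874's `π† ∘ Δ ∘ π` -/

include hU hφ hτ₁ hτ₂ in
/-- **`π_Uᵗ = π_U†`** — bilinear transpose = Hilbert adjoint at a unitary background (real `G′`). [cite: Balaban1985BackgroundPropagators, (3.119) p.419] -/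
theorem btrans_piOfU_eq_adjoint {Gp : SiteL2K ℂ d (fineP L m) c₀ W →ₗ[ℂ] SiteL2K ℂ d (fineP L m) c₀ W}
    (hGp : ∀ f, Gp (starW φ f) = starW φ (Gp f)) :
    btrans φ (piOfU L m φ η U Gp) = LinearMap.adjoint (piOfU L m φ η U Gp) := by
  show LinearMap.adjoint (realConj φ (piOfU L m φ η U Gp)) = _
  rw [(realConj_eq_self_iff φ _).2 (piOfU_starW L m φ η hU τ hφ hτ₁ hτ₂ hGp)]

include hU hφ hτ₁ hτ₂ in
/-- **`B9Eq3119DeltaPiCarrier`'s `Δ_π(U) = π_Uᵗ Δ^η(U) π_U` IS `B9Eq3119InvariantExtension`'s `π_U† ∘ Δ^η(U) ∘ π_U`** at a unitary background (real `G′`): the row's two (3.119) typings define ONE operator. [cite: Balaban1985BackgroundPropagators, (3.119) p.419] -/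
theorem deltaPiOfU_eq_adjoint_form {Gp : SiteL2K ℂ d (fineP L m) c₀ W →ₗ[ℂ] SiteL2K ℂ d (fineP L m) c₀ W}
    (hGp : ∀ f, Gp (starW φ f) = starW φ (Gp f)) :
    deltaPiOfU L m φ τ η U Gp = LinearMap.adjoint (piOfU L m φ η U Gp) ∘ₗ hessOp φ η U τ ∘ₗ piOfU L m φ η U Gp := by
  rw [deltaPiOfU, deltaPi, btrans_piOfU_eq_adjoint L m φ η hU τ hφ hτ₁ hτ₂ hGp]

include hU hφ hτ₁ hτ₂ in
/-- … in particular at print's own `G′ := (Δ′_a(U))⁻¹` (no reality letter; `hpos'` displayed — `B9Thm311DeltaPrimeA.laplacePrimeA_pos` discharges it). [cite: Balaban1985BackgroundPropagators, (3.119) p.419, (3.25) p.394] -/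
theorem deltaPiOfU_GpOfU_eq_adjoint_form
    (hpos' : ∀ x : SiteL2K ℂ d (fineP L m) c₀ W, x ≠ 0 → 0 < RCLike.re ⟪x, laplacePrimeA L m φ η U a' (c₁ := c₁) x⟫_ℂ) :
    deltaPiOfU L m φ τ η U (GpOfU L m φ η U a' hpos') =
      LinearMap.adjoint (piOfU L m φ η U (GpOfU L m φ η U a' hpos')) ∘ₗ hessOp φ η U τ ∘ₗ piOfU L m φ η U (GpOfU L m φ η U a' hpos') :=
  deltaPiOfU_eq_adjoint_form L m φ η hU τ hφ hτ₁ hτ₂ (GpOfU_starW L m φ η hU τ hφ hτ₁ hτ₂ a' hpos')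

include hU hφ hτ₁ hτ₂ in
/-- **HENCE `Δ_π(U)` IS A SYMMETRIC (HERMITIAN) OPERATOR** at a unitary background with a `*`-trace — print p. 392's «hermitian operator»
for the EXTENDED form (3.119): (II) proves BILINEAR symmetry (`tpair_deltaPiOfU_comm`); the sesquilinear `IsSymmetric` (needed by
`B11Eq103H1Complex.laplaceALatticeK_isSymmetric` ∕ `B9Eq3124GaugeModes.h124'_RLatticeK` when `Δ₁ := Δ_π`) follows from `π_Uᵗ = π_U†`. [cite: Balaban1985BackgroundPropagators, p.392, (3.119) p.419] -/
theorem deltaPiOfU_isSymmetric {Gp : SiteL2K ℂ d (fineP L m) c₀ W →ₗ[ℂ] SiteL2K ℂ d (fineP L m) c₀ W}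
    (hGp : ∀ f, Gp (starW φ f) = starW φ (Gp f)) : (deltaPiOfU L m φ τ η U Gp).IsSymmetric := by
  rw [deltaPiOfU_eq_adjoint_form L m φ η hU τ hφ hτ₁ hτ₂ hGp]
  exact B9Eq3119InvariantExtension.invariantExtension_isSymmetric _
    (B9Eq310HessianHermitian.hessOp_isSymmetric_of_trace φ τ hτ₁ hτ₂ η hU hφ)

include hU hφ hτ₁ hτ₂ in
/-- … at print's own `G′ := (Δ′_a(U))⁻¹`: `Δ_π(U)` is symmetric with no reality letter (`hpos'` displayed — `B9Thm311DeltaPrimeA.laplacePrimeA_pos` discharges it). [cite: Balaban1985BackgroundPropagators, p.392, (3.119) p.419] -/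
theorem deltaPiOfU_GpOfU_isSymmetric
    (hpos' : ∀ x : SiteL2K ℂ d (fineP L m) c₀ W, x ≠ 0 → 0 < RCLike.re ⟪x, laplacePrimeA L m φ η U a' (c₁ := c₁) x⟫_ℂ) :
    (deltaPiOfU L m φ τ η U (GpOfU L m φ η U a' hpos')).IsSymmetric :=
  deltaPiOfU_isSymmetric L m φ η hU τ hφ hτ₁ hτ₂ (GpOfU_starW L m φ η hU τ hφ hτ₁ hτ₂ a' hpos')

end Lattice

end Literature.MathematicalPhysics.QuantumFieldTheory.Balaban1983to89.B9Eq3119DeltaPiReality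

end
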